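import Summits.QuantumFields.QCD.Theses.NestedDissectionSea
import Summits.QuantumFields.QCD.Theorems.EarlyCrosserLaw.Negative.CellPositivityDomain
import Literature.MathematicalPhysics.QuantumFieldTheory.QCDPhaseQuenched
import Literature.Analysis.Complex.BacklundJensenAverage

/-!
# Line `accretive-coarse-jensen` — skeleton for the crux `EarlyCrosserLaw` (stmt-QuantumFields-13995)

Route `NestedDissectionSea` (QCD), crux `Summit.QuantumFields.QCD.Theses.NestedDissectionSea.EarlyCrosserLaw`
(rank 2).  Idea card `Cruxes/EarlyCrosserLaw/Ideas/accretive-coarse-jensen.md` (ideator 2, round 1; triage r1: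
pass ×3, merge-absorbs `laplacian-feshbach-cold-spot`).  Line card: `Lines/accretive-coarse-jensen.md`.

## Shape

Clause (a′) of the crux (window dilution of EARLY CROSSERS: a Dirichlet cell of a window box, or one of its
16 children, singular at a bare mass `μ' ≥ m_f(k)`) is TRANSFERRED to a statement that is LINEAR IN THE MEAN
EIGENVALUE MEASURE of the massless Dirichlet cell operator `M_Y = wilsonCell U 0 x s` and CONTINUOUS ACROSS
PAIR BIRTHS: the phase-quenched expectation of the **two-circle Jensen excess**

  `J_Y(c; r, R) := A_Y(R) − A_Y(r)`,  `A_Y(ρ) := ⨍_{|z−c|=ρ} log |charpoly(M_Y)(z)| |dz|`,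

summed over a grid of centres `c_n = (2n+1) r` covering the early segment `[0, −m_f(k)]` (radii `r < R = 2r`),
over the parent cell and its 16 children and over flavours, is `≤ δ_j log 2` with `Σ_j δ_j ≤ ε`
(`stub_jensenDilution`, the HARDEST stub).  For a monic `p = ∏ (X − u_i)` Mathlib's
`circleAverage_log_norm_sub_const_eq_log_radius_add_posLog` gives
`J = Σ_i min(log(R/r), log⁺(R/|u_i − c|))`, whence (`stub_crossingCharge`) every crossing mass within `r`
of `−c` charges `J ≥ log(R/r)` — NO non-vanishing hypothesis at the centre (the ideator's one-circle
`JensenDiscCount` needed `p(−c) ≠ 0`, false gauge-field-independently at `c = 4` on one-site cells,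
Disproof §4) — and (`stub_excessRegular`) `0 ≤ J ≤ #cell · log(R/r)` with `U ↦ J` a measurable observable.
The pins (b), (b″) are the YM-topology input `stub_pinnedLine` (an admissible regularisation whose line is
pinned two-sidedly by the parity observable), and `stub_jensenDilution` is asked of EVERY admissible
regularisation at every `(M₀, m, R)` where the pins hold (threshold loss `C`).  `EarlyCrosserLaw_of` is
the real proof: re-base `M₀ ↦ M₀ + C`; a cover event of (a′) forces a crossing `μ' ∈ [m_f(k), 0]` of the
parent or a child (upper end by the LANDED Negative lemma `wilsonCell_det_ne_zero_of_pos`, the level-`0`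
case of the accretive factorisation); the grid disc `n = ⌊−μ'/2r⌋₊` is charged `log 2`; Markov's
inequality for the OUTER phase-quenched probability (proved here: `outerProb_le_of_charge`) gives
`P(E) ≤ δ_j`.

The ACCRETIVE COARSE-GRAINING of the card (exact Schur/Feshbach elimination of `ran 1_{W ≥ c}`, `W` the
cell's own covariant Wilson term; harmonic factor drops out of `J` exactly; rank `1_{W<c} ≤ 0.56 c²|cell|`;
Ky Fan count; smooth-cutoff quasi-locality) is the named TOOLKIT for proving `stub_jensenDilution` — see the
line card; it introduces no definition into this skeleton (stubs are over existing declarations only).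

Sorries: exactly the four `stub_*`.  Everything else (`outerProb_le_of_charge`, `EarlyCrosserLaw_of`) is
proved, standard axioms.
-/

noncomputable section

open scoped BigOperators Matrix ComplexConjugate
open Filter MeasureTheory
open Literature.MathematicalPhysics.QuantumLattice Literature.MathematicalPhysics.QuantumFieldTheory
  Literature.Probability.LatticeModels
open Summit.QuantumFields.QCD.Theses.NestedDissectionSea

namespace Summit.QuantumFields.QCD.Cruxes.EarlyCrosserLaw.AccretiveCoarseJensen

open scoped Classical

/-- Local notation: the colour group `SU(3)`. -/
local notation "𝔾" => Matrix.specialUnitaryGroup (Fin 3) ℂ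

/-! ## The four stub statements (as named `Prop`s; `stub_*` below assert them) -/

/-- **Stub 1 — CROSSING CHARGE (two-circle Jensen count; deterministic, size M).**  For every SU(3)
field, every Dirichlet cell `(x, s)`, radii `0 < r < R` and real centre `c`: if the cell is singular at
bare mass `μ'` (i.e. `−μ'` is an eigenvalue of the massless cell operator `wilsonCell U 0 x s`, a root of its
characteristic polynomial — `wilsonDirac_mass_eq_add_scalar` restricted to the box) and `|μ' + c| ≤ r`,
then the two-circle Jensen excess of `log |charpoly|` about `c` is at least `log(R/r)`.
Proof route: charpoly is monic of degree `#cell` and splits over `ℂ`; `log‖p(z)‖ = Σ_i log‖z − u_i‖`;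
Mathlib `circleAverage_log_norm_sub_const_eq_log_radius_add_posLog` gives
`A(ρ) = #cell·log ρ + Σ_i log⁺(‖u_i − c‖/ρ)`, so `A(R) − A(r) = Σ_i min(log(R/r), log⁺(R/‖u_i−c‖)) ≥ log(R/r)`
as soon as one `u_i = −μ'` has `‖u_i − c‖ ≤ r`.  No hypothesis `p(c) ≠ 0` (roots AT the centre also
charge `log(R/r)`; cf. the U-independent root `μ' = −4` of one-site cells, Disproof §4 /
`wilsonCell_two_det_eq_zero_iff`). -/
def CrossingCharge : Prop :=
  ∀ (N : ℕ) [NeZero N] (U : GaugeConfig 4 N 𝔾) (x : TorusSite 4 N) (s : Fin 4 → ℕ)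
    (μ' c r R : ℝ), 0 < r → r < R → (wilsonCell U μ' x s).det = 0 → |μ' + c| ≤ r →
    Real.log (R / r) ≤
      Real.circleAverage (fun z : ℂ => Real.log ‖((wilsonCell U 0 x s).charpoly).eval z‖) (c : ℂ) R
        - Real.circleAverage (fun z : ℂ => Real.log ‖((wilsonCell U 0 x s).charpoly).eval z‖) (c : ℂ) r

/-- **Stub 2 — REGULARITY OF THE JENSEN EXCESS (deterministic/analytic, size M).**  For fixed cell data
and `0 < r < R` the two-circle Jensen excess is a MEASURABLE function of the gauge field (coefficients of
charpoly are polynomial in the link entries; `(U, θ) ↦ log‖p_U(c + ρe^{iθ})‖` is jointly Borel; parametric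
integral, `StronglyMeasurable.integral_prod_right`) with the deterministic two-sided bound
`0 ≤ J ≤ #cell · log(R/r)` (root form above: each root contributes a number in `[0, log(R/r)]`;
non-negativity is the subharmonic monotonicity of circle means of `log|p|`).  Empty cells (`#cell = 0`,
`p = 1`) give `J = 0`. -/
def ExcessRegular : Prop :=
  ∀ (N : ℕ) [NeZero N] (x : TorusSite 4 N) (s : Fin 4 → ℕ) (c r R : ℝ), 0 < r → r < R →
    (Measurable fun U : GaugeConfig 4 N 𝔾 =>
      Real.circleAverage (fun z : ℂ => Real.log ‖((wilsonCell U 0 x s).charpoly).eval z‖) (c : ℂ) R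
        - Real.circleAverage (fun z : ℂ => Real.log ‖((wilsonCell U 0 x s).charpoly).eval z‖) (c : ℂ) r) ∧
    ∀ U : GaugeConfig 4 N 𝔾,
      0 ≤ Real.circleAverage (fun z : ℂ => Real.log ‖((wilsonCell U 0 x s).charpoly).eval z‖) (c : ℂ) R
            - Real.circleAverage (fun z : ℂ => Real.log ‖((wilsonCell U 0 x s).charpoly).eval z‖) (c : ℂ) r ∧
      Real.circleAverage (fun z : ℂ => Real.log ‖((wilsonCell U 0 x s).charpoly).eval z‖) (c : ℂ) R
          - Real.circleAverage (fun z : ℂ => Real.log ‖((wilsonCell U 0 x s).charpoly).eval z‖) (c : ℂ) r ≤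
        (Fintype.card {p // wilsonBox x s p} : ℝ) * Real.log (R / r)

/-- **Stub 3 — THE PINNED LINE (Yang–Mills topology; shared-crux grade, size L–XL).**  For `N_f ∈ {2,3}`
there is ONE admissible regularisation (`HasMassScaling`, `HasAsymptoticScaling`) and `M₀ ≥ 0` such that for
every mass tuple `m > M₀` there is a physical size `R > 0` with the crux's two-sided parity pin VERBATIM:
(b) a distance `M > M₀` BELOW the line the torus determinant is negative with phase-quenched probability
`≥ 1/4` on every odd torus of physical side `≥ R`, and (b″) a distance `M > M₀` ABOVE the line it is negative
with probability `≤ 1/8` on odd tori of physical side in `[R, 2R]`, eventually in `k`.  Content: the parity of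
the Wilson spectral index (`WilsonDeterminantSign_holds`) jumps across the chiral critical line within a band
`o(a_k/Z_m)` — topological activity surviving the continuum limit at fixed physical volume `≳ R⁴`
(`P(Q odd) ≥ 1/4 ⇔ χ_t R⁴ ≳ 0.35`) and index modes crossing only `O(a²)` below the line.  By
`trivial_without_lowerPin` (Disproof §2) this is the ONLY content-bearing clause of the crux as typed; every
line on `EarlyCrosserLaw` needs it; it does not mention cells. -/
def PinnedLine : Prop :=
  ∀ Nf : ℕ, (Nf = 2 ∨ Nf = 3) → ∃ reg : QCDRegularisation Nf, reg.HasMassScaling ∧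
    (reg.scheme 0 0 0).HasAsymptoticScaling ∧ ∃ M₀ : ℝ, 0 ≤ M₀ ∧
    ∀ m : Fin Nf → ℝ, (∀ f, M₀ < m f) → ∃ R : ℝ, 0 < R ∧
      (∀ M : ℝ, M₀ < M → ∀ᶠ k : ℕ in Filter.atTop, ∀ S : ℕ, R ≤ reg.a k * (2 * S + 1) → let N : ℕ := 2 * S + 1; let mq : Fin Nf → ℝ := fun f => reg.mcrit k + reg.a k * m f / reg.Zm k; let wt : GaugeConfig 4 N (Matrix.specialUnitaryGroup (Fin 3) ℂ) → ℝ := fun U => ∏ f, ‖fermionDet (wilsonDirac (fundamentalRep (Fin 3)) U (mq f) 1)‖; (1 / 4 : ℝ) ≤ (∫ U, (if (fermionDet (wilsonDirac (fundamentalRep (Fin 3)) U (reg.mcrit k - reg.a k * M / reg.Zm k) 1)).re < 0 then (1 : ℝ) else 0) * wt U ∂(wilsonMeasure (d := 4) (L := N) (fundamentalRep (Fin 3)) (reg.β k))) / (∫ U, wt U ∂(wilsonMeasure (d := 4) (L := N) (fundamentalRep (Fin 3)) (reg.β k)))) ∧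
      (∀ M : ℝ, M₀ < M → ∀ᶠ k : ℕ in Filter.atTop, ∀ S : ℕ, R ≤ reg.a k * (2 * S + 1) → reg.a k * (2 * S + 1) ≤ 2 * R → let N : ℕ := 2 * S + 1; let mq : Fin Nf → ℝ := fun f => reg.mcrit k + reg.a k * m f / reg.Zm k; let wt : GaugeConfig 4 N (Matrix.specialUnitaryGroup (Fin 3) ℂ) → ℝ := fun U => ∏ f, ‖fermionDet (wilsonDirac (fundamentalRep (Fin 3)) U (mq f) 1)‖; (∫ U, (if (fermionDet (wilsonDirac (fundamentalRep (Fin 3)) U (reg.mcrit k + reg.a k * M / reg.Zm k) 1)).re < 0 then (1 : ℝ) else 0) * wt U ∂(wilsonMeasure (d := 4) (L := N) (fundamentalRep (Fin 3)) (reg.β k))) / (∫ U, wt U ∂(wilsonMeasure (d := 4) (L := N) (fundamentalRep (Fin 3)) (reg.β k))) ≤ (1 / 8 : ℝ))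

/-- **Stub 4 — JENSEN DILUTION AT PINNED LINES (the line's physics; HARDEST, open-problem grade).**
For `N_f ∈ {2,3}` and EVERY admissible regularisation `reg` there are a leaf size `b₀ ≥ 2`, a physical window
`ℓ > 0` and a threshold loss `C ≥ 0` such that whenever the two-sided pin (b) ∧ (b″) holds at `(M₀, m, R)`
(so `m_crit(k)` sits within `a_k M₀/Z_m` of the parity-jump line) and `m_f > M₀ + C`, then for every
`ε > 0`, eventually in `k`, on every odd torus of physical side `≥ R`, there is `δ ≥ 0` with `Σ_{j<J} δ_j ≤ ε`
such that for every window box `s` at scale `j` there are radii `r_f > 0` (the prover's choice — physically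
`r_f ≍ a_k (m_f − M₀ − C)/(3 Z_m)`, a third of the valence offset, so that the big discs stay `≳ 2h/3` left of
the physical branch `Re λ ≈ |m_crit|`) for which the phase-quenched expectation of the flavour-, grid- and
cell-summed two-circle Jensen excess

  `Σ_f Σ_{n ≤ ⌊−m_f(k)/2r_f⌋} ( J_parent((2n+1)r_f; r_f, 2r_f) + Σ_{16 children} J_child(…) )`

is `≤ δ_j · log 2`.  Since `E J = ∫ min(log 2, log⁺(2r/|u − c|)) dμ₁(u)` is a bounded continuous functional of
the MEAN EIGENVALUE MEASURE `μ₁` of the massless cell operator, this says: `μ₁` has window-summably small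
mass in the `2r`-neighbourhood of the early segment `[0, |m_crit| − h]`, complex (near-real, pair-collision)
eigenvalues INCLUDED — the crux's named failure mode is charged continuously through pair births.
Toolkit (line card): accretive Schur/Feshbach elimination of `ran 1_{W ≥ c}` (harmonic factor drops out of
`J` exactly, so only the `≤ 0.56c²|cell|`-dimensional coarse matrix function `F_c` is seen; a kernel vector
is COLD: crossing mass `≥ ⟨v, W v⟩/‖v‖²`), Ky Fan a-priori count, smooth-cutoff quasi-locality (BCFS),
then the route's carrier census (L4)–(L5) at the pinned line / `κ₀ ≥ 4/b` (Disproof §5).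
Why it might fail: an Aoki-type CLOUD of near-real eigenvalues with real-part scatter `∝ a` (not `a²–a³`,
KVZ) left of the branch gives `E J = O(1)` per window cell although exact crossings could still be rare. -/
def JensenDilution : Prop :=
  ∀ Nf : ℕ, (Nf = 2 ∨ Nf = 3) → ∀ reg : QCDRegularisation Nf, reg.HasMassScaling →
    (reg.scheme 0 0 0).HasAsymptoticScaling →
    ∃ b₀ : ℕ, 2 ≤ b₀ ∧ ∃ ℓ : ℝ, 0 < ℓ ∧ ∃ C : ℝ, 0 ≤ C ∧
    ∀ M₀ : ℝ, 0 ≤ M₀ → ∀ m : Fin Nf → ℝ, (∀ f, M₀ + C < m f) → ∀ R : ℝ, 0 < R →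
      (∀ M : ℝ, M₀ < M → ∀ᶠ k : ℕ in Filter.atTop, ∀ S : ℕ, R ≤ reg.a k * (2 * S + 1) → let N : ℕ := 2 * S + 1; let mq : Fin Nf → ℝ := fun f => reg.mcrit k + reg.a k * m f / reg.Zm k; let wt : GaugeConfig 4 N (Matrix.specialUnitaryGroup (Fin 3) ℂ) → ℝ := fun U => ∏ f, ‖fermionDet (wilsonDirac (fundamentalRep (Fin 3)) U (mq f) 1)‖; (1 / 4 : ℝ) ≤ (∫ U, (if (fermionDet (wilsonDirac (fundamentalRep (Fin 3)) U (reg.mcrit k - reg.a k * M / reg.Zm k) 1)).re < 0 then (1 : ℝ) else 0) * wt U ∂(wilsonMeasure (d := 4) (L := N) (fundamentalRep (Fin 3)) (reg.β k))) / (∫ U, wt U ∂(wilsonMeasure (d := 4) (L := N) (fundamentalRep (Fin 3)) (reg.β k)))) →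
      (∀ M : ℝ, M₀ < M → ∀ᶠ k : ℕ in Filter.atTop, ∀ S : ℕ, R ≤ reg.a k * (2 * S + 1) → reg.a k * (2 * S + 1) ≤ 2 * R → let N : ℕ := 2 * S + 1; let mq : Fin Nf → ℝ := fun f => reg.mcrit k + reg.a k * m f / reg.Zm k; let wt : GaugeConfig 4 N (Matrix.specialUnitaryGroup (Fin 3) ℂ) → ℝ := fun U => ∏ f, ‖fermionDet (wilsonDirac (fundamentalRep (Fin 3)) U (mq f) 1)‖; (∫ U, (if (fermionDet (wilsonDirac (fundamentalRep (Fin 3)) U (reg.mcrit k + reg.a k * M / reg.Zm k) 1)).re < 0 then (1 : ℝ) else 0) * wt U ∂(wilsonMeasure (d := 4) (L := N) (fundamentalRep (Fin 3)) (reg.β k))) / (∫ U, wt U ∂(wilsonMeasure (d := 4) (L := N) (fundamentalRep (Fin 3)) (reg.β k))) ≤ (1 / 8 : ℝ)) →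
      ∀ ε : ℝ, 0 < ε → ∀ᶠ k : ℕ in Filter.atTop, ∀ S : ℕ, R ≤ reg.a k * (2 * S + 1) →
        let N : ℕ := 2 * S + 1
        let mq : Fin Nf → ℝ := fun f => reg.mcrit k + reg.a k * m f / reg.Zm k
        let wt : GaugeConfig 4 N 𝔾 → ℝ := fun U =>
          ∏ f, ‖fermionDet (wilsonDirac (fundamentalRep (Fin 3)) U (mq f) 1)‖
        let J : GaugeConfig 4 N 𝔾 → TorusSite 4 N → (Fin 4 → ℕ) → ℝ → ℝ → ℝ := fun U x s' c r =>
          Real.circleAverage (fun z : ℂ => Real.log ‖((wilsonCell U 0 x s').charpoly).eval z‖) (c : ℂ) (2 * r)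
            - Real.circleAverage (fun z : ℂ => Real.log ‖((wilsonCell U 0 x s').charpoly).eval z‖) (c : ℂ) r
        let Jw : ℕ := Nat.log 2 (⌊ℓ / reg.a k⌋₊ / b₀) + 1
        ∃ δ : ℕ → ℝ, (∀ j, 0 ≤ δ j) ∧ ∑ j ∈ Finset.range Jw, δ j ≤ ε ∧
          ∀ j < Jw, ∀ s : Fin 4 → ℕ,
            (∀ i, b₀ * 2 ^ j ≤ s i ∧ s i < b₀ * 2 ^ (j + 2) ∧ s i ≤ N ∧ (s i : ℝ) * reg.a k ≤ ℓ) →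
            ∃ r : Fin Nf → ℝ, (∀ f, 0 < r f) ∧
              (∫ U, (∑ f, ∑ n ∈ Finset.range (⌊(-mq f) / (2 * r f)⌋₊ + 1),
                  (J U 0 s ((2 * (n : ℝ) + 1) * r f) (r f) +
                    ∑ ε : Fin 4 → Bool,
                      J U (halfCorner s ε) (halfSides s ε) ((2 * (n : ℝ) + 1) * r f) (r f))) * wt U
                  ∂(wilsonMeasure (d := 4) (L := N) (fundamentalRep (Fin 3)) (reg.β k))) /
                (∫ U, wt U ∂(wilsonMeasure (d := 4) (L := N) (fundamentalRep (Fin 3)) (reg.β k)))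
              ≤ δ j * Real.log 2

/-! ## The registered stubs -/

/-- Stub 1 (deterministic, size M): crossing charge. See `CrossingCharge`. -/
theorem stub_crossingCharge : CrossingCharge := by
  sorry

/-- Stub 2 (analytic, size M): regularity and two-sided bound of the Jensen excess. See `ExcessRegular`. -/
theorem stub_excessRegular : ExcessRegular := by
  sorry

/-- Stub 3 (YM topology, size L–XL, shared-crux grade): the two-sided pinned line. See `PinnedLine`. -/
theorem stub_pinnedLine : PinnedLine := by
  sorry

/-- Stub 4 (HARDEST, open): Jensen dilution at pinned lines. See `JensenDilution`. -/
theorem stub_jensenDilution : JensenDilution := by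
  sorry

/-! ## Glue (proved): Markov's inequality for the OUTER phase-quenched probability -/

/-- **Markov for the outer reweighted probability.**  On a finite measure space with a measurable bounded
non-negative weight `wt` and a measurable bounded non-negative charge `F`: if every point of an ARBITRARY
(possibly non-measurable) event `E` carries charge `≥ L > 0` and the reweighted mean of `F` is `≤ δ L`, then
the reweighted outer probability of `E` (Bochner conventions: non-integrable ⇒ `∫ = 0`, `x / 0 = 0`) is
`≤ δ`. [folklore] -/
theorem outerProb_le_of_charge {X : Type*} [MeasurableSpace X] (μ : Measure X) [IsFiniteMeasure μ]
    (wt F : X → ℝ) (hwt : Measurable wt) (hwt0 : ∀ U, 0 ≤ wt U) (Cw : ℝ) (hwtC : ∀ U, wt U ≤ Cw)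
    (hF : Measurable F) (hF0 : ∀ U, 0 ≤ F U) (B : ℝ) (hFB : ∀ U, F U ≤ B)
    (E : X → Prop) [DecidablePred E] (L : ℝ) (hL : 0 < L) (hE : ∀ U, E U → L ≤ F U) (δ : ℝ)
    (hbound : (∫ U, F U * wt U ∂μ) / (∫ U, wt U ∂μ) ≤ δ * L) :
    (∫ U, (if E U then (1 : ℝ) else 0) * wt U ∂μ) / (∫ U, wt U ∂μ) ≤ δ := by
  have hFwt_int : Integrable (fun U => F U * wt U) μ := by
    refine Integrable.of_bound (hF.mul hwt).aestronglyMeasurable (B * Cw)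
      (Eventually.of_forall fun U => ?_)
    rw [Real.norm_eq_abs, abs_of_nonneg (mul_nonneg (hF0 U) (hwt0 U))]
    exact mul_le_mul (hFB U) (hwtC U) (hwt0 U) ((hF0 U).trans (hFB U))
  have hZ0 : 0 ≤ ∫ U, wt U ∂μ := integral_nonneg hwt0
  have hb0 : 0 ≤ ∫ U, F U * wt U ∂μ := integral_nonneg fun U => mul_nonneg (hF0 U) (hwt0 U)
  have key : L * ∫ U, (if E U then (1 : ℝ) else 0) * wt U ∂μ ≤ ∫ U, F U * wt U ∂μ := by
    by_cases hint : Integrable (fun U => (if E U then (1 : ℝ) else 0) * wt U) μ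
    · rw [← integral_const_mul]
      refine integral_mono (hint.const_mul L) hFwt_int fun U => ?_
      dsimp only
      by_cases hU : E U
      · rw [if_pos hU, one_mul]
        exact mul_le_mul_of_nonneg_right (hE U hU) (hwt0 U)
      · rw [if_neg hU, zero_mul, mul_zero]
        exact mul_nonneg (hF0 U) (hwt0 U)
    · rw [integral_undef hint, mul_zero]
      exact hb0
  have h1 : ∫ U, (if E U then (1 : ℝ) else 0) * wt U ∂μ ≤ (∫ U, F U * wt U ∂μ) / L := by
    rw [le_div_iff₀ hL]
    linarith [key]
  calc (∫ U, (if E U then (1 : ℝ) else 0) * wt U ∂μ) / (∫ U, wt U ∂μ)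
      ≤ ((∫ U, F U * wt U ∂μ) / L) / (∫ U, wt U ∂μ) := div_le_div_of_nonneg_right h1 hZ0
    _ = ((∫ U, F U * wt U ∂μ) / (∫ U, wt U ∂μ)) / L := by rw [div_right_comm]
    _ ≤ δ := by rw [div_le_iff₀ hL]; exact hbound

/-! ## The composition: the four stubs imply the crux BY NAME -/

/-- **`EarlyCrosserLaw` from the four stubs** (real proof, no `sorry`).  Re-base the threshold
`M₀ ↦ M₀ + C`; the pins pass through (their guard is `M₀ < M`); for (a′): a cover event forces a crossing
`μ'` of the parent or of a child with `m_f(k) ≤ μ' ≤ 0` (upper end: landed Negative lemma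
`wilsonCell_det_ne_zero_of_pos`), the grid disc `n = ⌊−μ'/(2 r_f)⌋₊` contains `−μ'` within `r_f` of its
centre, `stub_crossingCharge` charges it `log 2`, all other terms are `≥ 0` (`stub_excessRegular`), and
`outerProb_le_of_charge` (Markov; measurability and bounds from `stub_excessRegular`, the weight is
continuous on the compact configuration space) turns the expectation bound of `stub_jensenDilution` into
`P(E) ≤ δ_j`. -/
theorem EarlyCrosserLaw_of :
    CrossingCharge → ExcessRegular → PinnedLine → JensenDilution → EarlyCrosserLaw := by
  intro hC hReg hPin hDil Nf hNf
  obtain ⟨reg, hms, has, M₀, hM₀, hm⟩ := hPin Nf hNf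
  obtain ⟨b₀, hb₀, ℓ, hℓ, C, hC0, hdil⟩ := hDil Nf hNf reg hms has
  refine ⟨reg, hms, has, M₀ + C, by linarith, b₀, hb₀, ℓ, hℓ, fun m hmm => ?_⟩
  have hmm₀ : ∀ f, M₀ < m f := fun f => by have := hmm f; linarith
  obtain ⟨R, hR, hB, hB2⟩ := hm m hmm₀
  refine ⟨R, hR, ?_, fun M hM => hB M (by linarith), fun M hM => hB2 M (by linarith)⟩
  -- clause (a′) from the Jensen dilution
  intro ε hε
  have hev := hdil M₀ hM₀ m hmm R hR hB hB2 ε hε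
  filter_upwards [hev] with k hk
  intro S hS
  have hk' := hk S hS
  dsimp only at hk' ⊢
  obtain ⟨δ, hδ0, hδs, hδ⟩ := hk'
  refine ⟨δ, hδ0, hδs, ?_⟩
  intro j hj s hs E hE
  obtain ⟨r, hr, hbound⟩ := hδ j hj s hs
  -- abbreviations
  have hr2 : ∀ f, 0 < 2 * r f := fun f => by linarith [hr f]
  have hrR : ∀ f, r f < 2 * r f := fun f => by linarith [hr f]
  have hlog2 : ∀ f, Real.log (2 * r f / r f) = Real.log 2 := fun f => by
    rw [mul_div_assoc, div_self (hr f).ne', mul_one]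
  have hlog2pos : 0 < Real.log 2 := Real.log_pos (by norm_num)
  -- the weight: continuous on a compact space, hence measurable, bounded, and it is non-negative
  have hwt_cont : Continuous fun U : GaugeConfig 4 (2 * S + 1) 𝔾 =>
      ∏ f, ‖fermionDet (wilsonDirac (fundamentalRep (Fin 3)) U
        (reg.mcrit k + reg.a k * m f / reg.Zm k) 1)‖ :=
    continuous_finsetProd _ fun f _ =>
      ((continuous_wilsonDirac (fundamentalRep (Fin 3)) (continuous_fundamentalRep (Fin 3)) _ _).matrix_det).norm
  have hwt0 : ∀ U : GaugeConfig 4 (2 * S + 1) 𝔾,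
      0 ≤ ∏ f, ‖fermionDet (wilsonDirac (fundamentalRep (Fin 3)) U
        (reg.mcrit k + reg.a k * m f / reg.Zm k) 1)‖ :=
    fun U => Finset.prod_nonneg fun f _ => norm_nonneg _
  obtain ⟨Cw, hCw⟩ : ∃ Cw : ℝ, ∀ U : GaugeConfig 4 (2 * S + 1) 𝔾,
      ∏ f, ‖fermionDet (wilsonDirac (fundamentalRep (Fin 3)) U
        (reg.mcrit k + reg.a k * m f / reg.Zm k) 1)‖ ≤ Cw := by
    obtain ⟨U₀, -, hU₀⟩ := (isCompact_univ (X := GaugeConfig 4 (2 * S + 1) 𝔾)).exists_isMaxOn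
      Set.univ_nonempty hwt_cont.continuousOn
    exact ⟨_, fun U => hU₀ (Set.mem_univ U)⟩
  -- the charge functional: measurable, non-negative, bounded (stub 2)
  have hJ := fun (x : TorusSite 4 (2 * S + 1)) (s' : Fin 4 → ℕ) (c : ℝ) (f : Fin Nf) =>
    hReg (2 * S + 1) x s' c (r f) (2 * r f) (hr f) (hrR f)
  refine outerProb_le_of_charge
    (wilsonMeasure (d := 4) (L := 2 * S + 1) (fundamentalRep (Fin 3)) (reg.β k))
    (fun U => ∏ f, ‖fermionDet (wilsonDirac (fundamentalRep (Fin 3)) U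
      (reg.mcrit k + reg.a k * m f / reg.Zm k) 1)‖)
    (fun U => ∑ f, ∑ n ∈ Finset.range (⌊-(reg.mcrit k + reg.a k * m f / reg.Zm k) / (2 * r f)⌋₊ + 1),
      ((Real.circleAverage (fun z : ℂ => Real.log ‖((wilsonCell U 0 0 s).charpoly).eval z‖)
            (((2 * (n : ℝ) + 1) * r f : ℝ) : ℂ) (2 * r f)
          - Real.circleAverage (fun z : ℂ => Real.log ‖((wilsonCell U 0 0 s).charpoly).eval z‖)
            (((2 * (n : ℝ) + 1) * r f : ℝ) : ℂ) (r f)) +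
        ∑ ε : Fin 4 → Bool,
          (Real.circleAverage
              (fun z : ℂ => Real.log ‖((wilsonCell U 0 (halfCorner s ε) (halfSides s ε)).charpoly).eval z‖)
              (((2 * (n : ℝ) + 1) * r f : ℝ) : ℂ) (2 * r f)
            - Real.circleAverage
              (fun z : ℂ => Real.log ‖((wilsonCell U 0 (halfCorner s ε) (halfSides s ε)).charpoly).eval z‖)
              (((2 * (n : ℝ) + 1) * r f : ℝ) : ℂ) (r f))))
    hwt_cont.measurable hwt0 Cw hCw ?_ ?_
    (∑ f, ∑ n ∈ Finset.range (⌊-(reg.mcrit k + reg.a k * m f / reg.Zm k) / (2 * r f)⌋₊ + 1),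
      ((Fintype.card {p // wilsonBox (0 : TorusSite 4 (2 * S + 1)) s p} : ℝ) * Real.log (2 * r f / r f) +
        ∑ ε : Fin 4 → Bool,
          (Fintype.card {p // wilsonBox (halfCorner s ε : TorusSite 4 (2 * S + 1)) (halfSides s ε) p} : ℝ) *
            Real.log (2 * r f / r f)))
    ?_ E (Real.log 2) hlog2pos ?_ (δ j) hbound
  · -- measurability of the charge
    refine Finset.measurable_sum _ fun f _ => Finset.measurable_sum _ fun n _ => ?_
    refine Measurable.add (hJ 0 s _ f).1 (Finset.measurable_sum _ fun ε _ => ?_)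
    exact (hJ (halfCorner s ε) (halfSides s ε) _ f).1
  · -- non-negativity of the charge
    intro U
    refine Finset.sum_nonneg fun f _ => Finset.sum_nonneg fun n _ => add_nonneg ?_ ?_
    · exact ((hJ 0 s _ f).2 U).1
    · exact Finset.sum_nonneg fun ε _ => ((hJ (halfCorner s ε) (halfSides s ε) _ f).2 U).1
  · -- boundedness of the charge
    intro U
    refine Finset.sum_le_sum fun f _ => Finset.sum_le_sum fun n _ => add_le_add ?_ ?_
    · exact ((hJ 0 s _ f).2 U).2
    · exact Finset.sum_le_sum fun ε _ => ((hJ (halfCorner s ε) (halfSides s ε) _ f).2 U).2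
  · -- every configuration of the cover event carries charge ≥ log 2
    intro U hU
    obtain ⟨f, μ', hμ'v, hsing⟩ := hE U hU
    -- the crossing lies at a non-positive bare mass (positivity domain, landed Negative lemma)
    have hμ'0 : μ' ≤ 0 := by
      by_contra hpos
      push Not at hpos
      rcases hsing with h | ⟨c₀, h⟩
      · exact Summit.QuantumFields.QCD.Theorems.EarlyCrosserLawNegative.wilsonCell_det_ne_zero_of_pos
          U hpos _ _ h
      · exact Summit.QuantumFields.QCD.Theorems.EarlyCrosserLawNegative.wilsonCell_det_ne_zero_of_pos
          U hpos _ _ h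
    -- the grid disc containing −μ'
    set t : ℝ := -μ' with ht
    have ht0 : 0 ≤ t := by linarith
    have htv : t ≤ -(reg.mcrit k + reg.a k * m f / reg.Zm k) := by linarith
    set n : ℕ := ⌊t / (2 * r f)⌋₊ with hn
    have hn_mem : n ∈ Finset.range (⌊-(reg.mcrit k + reg.a k * m f / reg.Zm k) / (2 * r f)⌋₊ + 1) := by
      rw [Finset.mem_range, Nat.lt_add_one_iff]
      exact Nat.floor_mono (div_le_div_of_nonneg_right htv (hr2 f).le)
    have hn_le : (n : ℝ) ≤ t / (2 * r f) := Nat.floor_le (div_nonneg ht0 (hr2 f).le)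
    have hn_lt : t / (2 * r f) < n + 1 := Nat.lt_floor_add_one _
    have hcentre : |μ' + (2 * (n : ℝ) + 1) * r f| ≤ r f := by
      have h1 : (n : ℝ) * (2 * r f) ≤ t := (le_div_iff₀ (hr2 f)).mp hn_le
      have h2 : t < ((n : ℝ) + 1) * (2 * r f) := (div_lt_iff₀ (hr2 f)).mp hn_lt
      rw [abs_le]
      constructor
      · linarith
      · linarith
    -- the charged term
    have hterm : Real.log 2 ≤
        (Real.circleAverage (fun z : ℂ => Real.log ‖((wilsonCell U 0 0 s).charpoly).eval z‖)
              (((2 * (n : ℝ) + 1) * r f : ℝ) : ℂ) (2 * r f)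
            - Real.circleAverage (fun z : ℂ => Real.log ‖((wilsonCell U 0 0 s).charpoly).eval z‖)
              (((2 * (n : ℝ) + 1) * r f : ℝ) : ℂ) (r f)) +
          ∑ ε : Fin 4 → Bool,
            (Real.circleAverage
                (fun z : ℂ => Real.log ‖((wilsonCell U 0 (halfCorner s ε) (halfSides s ε)).charpoly).eval z‖)
                (((2 * (n : ℝ) + 1) * r f : ℝ) : ℂ) (2 * r f)
              - Real.circleAverage
                (fun z : ℂ => Real.log ‖((wilsonCell U 0 (halfCorner s ε) (halfSides s ε)).charpoly).eval z‖)
                (((2 * (n : ℝ) + 1) * r f : ℝ) : ℂ) (r f)) := by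
      rcases hsing with hpar | ⟨c₀, hchild⟩
      · have h1 := hC (2 * S + 1) U 0 s μ' ((2 * (n : ℝ) + 1) * r f) (r f) (2 * r f) (hr f) (hrR f)
          hpar hcentre
        rw [hlog2 f] at h1
        exact le_add_of_le_of_nonneg h1
          (Finset.sum_nonneg fun ε _ => ((hJ (halfCorner s ε) (halfSides s ε) _ f).2 U).1)
      · have h1 := hC (2 * S + 1) U (halfCorner s c₀) (halfSides s c₀) μ' ((2 * (n : ℝ) + 1) * r f)
          (r f) (2 * r f) (hr f) (hrR f) hchild hcentre
        rw [hlog2 f] at h1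
        refine le_add_of_nonneg_of_le ((hJ 0 s _ f).2 U).1 (h1.trans ?_)
        exact Finset.single_le_sum
          (f := fun ε : Fin 4 → Bool =>
            Real.circleAverage
                (fun z : ℂ => Real.log ‖((wilsonCell U 0 (halfCorner s ε) (halfSides s ε)).charpoly).eval z‖)
                (((2 * (n : ℝ) + 1) * r f : ℝ) : ℂ) (2 * r f)
              - Real.circleAverage
                (fun z : ℂ => Real.log ‖((wilsonCell U 0 (halfCorner s ε) (halfSides s ε)).charpoly).eval z‖)
                (((2 * (n : ℝ) + 1) * r f : ℝ) : ℂ) (r f))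
          (fun ε _ => ((hJ (halfCorner s ε) (halfSides s ε) _ f).2 U).1) (Finset.mem_univ c₀)
    -- sum over the grid and the flavours
    refine hterm.trans ?_
    refine le_trans ?_ (Finset.single_le_sum (f := fun f' : Fin Nf =>
        ∑ n ∈ Finset.range (⌊-(reg.mcrit k + reg.a k * m f' / reg.Zm k) / (2 * r f')⌋₊ + 1),
          ((Real.circleAverage (fun z : ℂ => Real.log ‖((wilsonCell U 0 0 s).charpoly).eval z‖)
                (((2 * (n : ℝ) + 1) * r f' : ℝ) : ℂ) (2 * r f')
              - Real.circleAverage (fun z : ℂ => Real.log ‖((wilsonCell U 0 0 s).charpoly).eval z‖)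
                (((2 * (n : ℝ) + 1) * r f' : ℝ) : ℂ) (r f')) +
            ∑ ε : Fin 4 → Bool,
              (Real.circleAverage
                  (fun z : ℂ => Real.log ‖((wilsonCell U 0 (halfCorner s ε) (halfSides s ε)).charpoly).eval z‖)
                  (((2 * (n : ℝ) + 1) * r f' : ℝ) : ℂ) (2 * r f')
                - Real.circleAverage
                  (fun z : ℂ => Real.log ‖((wilsonCell U 0 (halfCorner s ε) (halfSides s ε)).charpoly).eval z‖)
                  (((2 * (n : ℝ) + 1) * r f' : ℝ) : ℂ) (r f'))))
      (fun f' _ => Finset.sum_nonneg fun n _ => add_nonneg ((hJ 0 s _ f').2 U).1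
        (Finset.sum_nonneg fun ε _ => ((hJ (halfCorner s ε) (halfSides s ε) _ f').2 U).1))
      (Finset.mem_univ f))
    exact Finset.single_le_sum (f := fun n : ℕ =>
        (Real.circleAverage (fun z : ℂ => Real.log ‖((wilsonCell U 0 0 s).charpoly).eval z‖)
              (((2 * (n : ℝ) + 1) * r f : ℝ) : ℂ) (2 * r f)
            - Real.circleAverage (fun z : ℂ => Real.log ‖((wilsonCell U 0 0 s).charpoly).eval z‖)
              (((2 * (n : ℝ) + 1) * r f : ℝ) : ℂ) (r f)) +
          ∑ ε : Fin 4 → Bool,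
            (Real.circleAverage
                (fun z : ℂ => Real.log ‖((wilsonCell U 0 (halfCorner s ε) (halfSides s ε)).charpoly).eval z‖)
                (((2 * (n : ℝ) + 1) * r f : ℝ) : ℂ) (2 * r f)
              - Real.circleAverage
                (fun z : ℂ => Real.log ‖((wilsonCell U 0 (halfCorner s ε) (halfSides s ε)).charpoly).eval z‖)
                (((2 * (n : ℝ) + 1) * r f : ℝ) : ℂ) (r f)))
      (fun n _ => add_nonneg ((hJ 0 s _ f).2 U).1
        (Finset.sum_nonneg fun ε _ => ((hJ (halfCorner s ε) (halfSides s ε) _ f).2 U).1))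
      hn_mem

/-- **The skeleton IS the crux proof modulo the four declared stubs** (sorry-tainted only through them):
`EarlyCrosserLaw` BY NAME from `stub_crossingCharge`, `stub_excessRegular`, `stub_pinnedLine`,
`stub_jensenDilution` via the sorry-free composition `EarlyCrosserLaw_of`. -/
theorem EarlyCrosserLaw_skeleton : EarlyCrosserLaw :=
  EarlyCrosserLaw_of stub_crossingCharge stub_excessRegular stub_pinnedLine stub_jensenDilution

end Summit.QuantumFields.QCD.Cruxes.EarlyCrosserLaw.AccretiveCoarseJensen

end
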